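import Mathlib
import Summits.Ventures.PercRepro.TriangleCapStar
import Summits.Ventures.PercRepro.TriangleCapRowPlusThree

/-!
# PercRepro — the row `m = k + 3` is exact: the star plus four disjoint leaf edges attains `C(k − 1, 2) + 8`
for `k ≥ 9` (p3, gen 31; the companion of TriangleCapRowPlusThree)

* `starPlusFour k` — the star `K_{1,k−1}` with centre `0` plus the leaf edges `{1, 2}`, `{3, 4}`, `{5, 6}`, `{7, 8}`
  on `Fin k` (the windmill `W₄` at `k = 9`), with its decidable adjacency and `starPlusFour_adj`;
* `k4mFree_starPlusFour` — it is `K₄⁻`-free: the adjacent ordered pairs inside a `4`-set have the centre as a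
  coordinate (at most `2 · 1 · 3`) or lie in the off-diagonals of the four traces on the leaf pairs, pairwise
  disjoint subsets of `S ∖ {0}`;
* the degrees (`deg_starPlusFour`, for `k ≥ 9`): `k − 1` at the centre, `2` at `1 … 8`, `1` elsewhere;
  `cherries_starPlusFour = C(k − 1, 2) + 8`, `sum_deg_starPlusFour = 2k + 6`, `card_edges_starPlusFour = k + 3`;
* **`exists_k4mFree_row_plus_three`** / **`row_plus_three_exact`** — for every `k ≥ 9` the `K₄⁻`-free cherry
  maximum at `(k, k + 3)` is exactly `C(k − 1, 2) + 8`; `row_plus_three_values` — `36 · 44 · 53` at `k = 9, 10, 11`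
  (the census's `(9, 12) 36`).

Axioms: standard.
-/

namespace PercRepro

namespace TriangleCap

namespace C047

open Finset

/-- The star with centre `0` plus the three disjoint leaf edges `{1, 2}`, `{3, 4}`, `{5, 6}` (a graph on `Fin k`
for every `k`). -/
def starPlusFour (k : ℕ) : SimpleGraph (Fin k) where
  Adj i j := (i.val = 0 ∧ j.val ≠ 0) ∨ (j.val = 0 ∧ i.val ≠ 0) ∨ (i.val = 1 ∧ j.val = 2) ∨
    (i.val = 2 ∧ j.val = 1) ∨ (i.val = 3 ∧ j.val = 4) ∨ (i.val = 4 ∧ j.val = 3) ∨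
    (i.val = 5 ∧ j.val = 6) ∨ (i.val = 6 ∧ j.val = 5) ∨ (i.val = 7 ∧ j.val = 8) ∨ (i.val = 8 ∧ j.val = 7)
  symm := ⟨fun i j h => by
    rcases h with ⟨h1, h2⟩ | ⟨h1, h2⟩ | ⟨h1, h2⟩ | ⟨h1, h2⟩ | ⟨h1, h2⟩ | ⟨h1, h2⟩ | ⟨h1, h2⟩ | ⟨h1, h2⟩ |
      ⟨h1, h2⟩ | ⟨h1, h2⟩
    · exact Or.inr (Or.inl ⟨h1, h2⟩)
    · exact Or.inl ⟨h1, h2⟩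
    · exact Or.inr (Or.inr (Or.inr (Or.inl ⟨h2, h1⟩)))
    · exact Or.inr (Or.inr (Or.inl ⟨h2, h1⟩))
    · exact Or.inr (Or.inr (Or.inr (Or.inr (Or.inr (Or.inl ⟨h2, h1⟩)))))
    · exact Or.inr (Or.inr (Or.inr (Or.inr (Or.inl ⟨h2, h1⟩))))
    · exact Or.inr (Or.inr (Or.inr (Or.inr (Or.inr (Or.inr (Or.inr (Or.inl ⟨h2, h1⟩)))))))
    · exact Or.inr (Or.inr (Or.inr (Or.inr (Or.inr (Or.inr (Or.inl ⟨h2, h1⟩))))))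
    · exact Or.inr (Or.inr (Or.inr (Or.inr (Or.inr (Or.inr (Or.inr (Or.inr (Or.inr ⟨h2, h1⟩))))))))
    · exact Or.inr (Or.inr (Or.inr (Or.inr (Or.inr (Or.inr (Or.inr (Or.inr (Or.inl ⟨h2, h1⟩))))))))⟩
  loopless := ⟨fun i h => by
    rcases h with ⟨h1, h2⟩ | ⟨h1, h2⟩ | ⟨h1, h2⟩ | ⟨h1, h2⟩ | ⟨h1, h2⟩ | ⟨h1, h2⟩ | ⟨h1, h2⟩ |
      ⟨h1, h2⟩ | ⟨h1, h2⟩ | ⟨h1, h2⟩ <;> omega⟩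

/-- Adjacency in `starPlusFour k` is decidable. -/
instance decidableRelStarPlusFour (k : ℕ) : DecidableRel (starPlusFour k).Adj :=
  fun i j => inferInstanceAs (Decidable ((i.val = 0 ∧ j.val ≠ 0) ∨ (j.val = 0 ∧ i.val ≠ 0) ∨
    (i.val = 1 ∧ j.val = 2) ∨ (i.val = 2 ∧ j.val = 1) ∨ (i.val = 3 ∧ j.val = 4) ∨ (i.val = 4 ∧ j.val = 3) ∨
    (i.val = 5 ∧ j.val = 6) ∨ (i.val = 6 ∧ j.val = 5) ∨ (i.val = 7 ∧ j.val = 8) ∨ (i.val = 8 ∧ j.val = 7)))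

/-- Adjacency in `starPlusFour k`, unfolded. -/
theorem starPlusFour_adj (k : ℕ) (i j : Fin k) :
    (starPlusFour k).Adj i j ↔ (i.val = 0 ∧ j.val ≠ 0) ∨ (j.val = 0 ∧ i.val ≠ 0) ∨
      (i.val = 1 ∧ j.val = 2) ∨ (i.val = 2 ∧ j.val = 1) ∨ (i.val = 3 ∧ j.val = 4) ∨
      (i.val = 4 ∧ j.val = 3) ∨ (i.val = 5 ∧ j.val = 6) ∨ (i.val = 6 ∧ j.val = 5) ∨ (i.val = 7 ∧ j.val = 8) ∨
      (i.val = 8 ∧ j.val = 7) := Iff.rfl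

/-- The adjacent ordered pairs inside `S` have the centre as a coordinate (the other off the centre) or lie in the
off-diagonal of one of the traces `S ∩ {1, 2}`, `S ∩ {3, 4}`, `S ∩ {5, 6}`, `S ∩ {7, 8}`. -/
theorem adjPairs_starPlusFour_le (k : ℕ) (S : Finset (Fin k)) :
    adjPairs (starPlusFour k) S ≤
      2 * ((S.filter (fun i : Fin k => i.val = 0)).card * (S.filter (fun i : Fin k => ¬ i.val = 0)).card) +
        (S.filter (fun i : Fin k => i.val = 1 ∨ i.val = 2)).offDiag.card +
        (S.filter (fun i : Fin k => i.val = 3 ∨ i.val = 4)).offDiag.card +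
        (S.filter (fun i : Fin k => i.val = 5 ∨ i.val = 6)).offDiag.card +
        (S.filter (fun i : Fin k => i.val = 7 ∨ i.val = 8)).offDiag.card := by
  unfold adjPairs
  set C := S.filter (fun i : Fin k => i.val = 0) with hC
  set S' := S.filter (fun i : Fin k => ¬ i.val = 0) with hS'
  set P := S.filter (fun i : Fin k => i.val = 1 ∨ i.val = 2) with hP
  set Q := S.filter (fun i : Fin k => i.val = 3 ∨ i.val = 4) with hQ
  set W := S.filter (fun i : Fin k => i.val = 5 ∨ i.val = 6) with hW
  set X := S.filter (fun i : Fin k => i.val = 7 ∨ i.val = 8) with hX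
  have hsub : (S ×ˢ S).filter (fun p => (starPlusFour k).Adj p.1 p.2) ⊆
      C ×ˢ S' ∪ S' ×ˢ C ∪ P.offDiag ∪ Q.offDiag ∪ W.offDiag ∪ X.offDiag := by
    intro p hp
    rw [mem_filter, mem_product] at hp
    obtain ⟨⟨h1, h2⟩, hadj⟩ := hp
    rw [starPlusFour_adj] at hadj
    rw [mem_union, mem_union, mem_union, mem_union, mem_union, mem_product, mem_product, mem_offDiag,
      mem_offDiag, mem_offDiag, mem_offDiag, hC, hS', hP, hQ, hW, hX, mem_filter, mem_filter, mem_filter,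
      mem_filter, mem_filter, mem_filter, mem_filter, mem_filter, mem_filter, mem_filter, mem_filter,
      mem_filter]
    rcases hadj with ⟨ha, hb⟩ | ⟨ha, hb⟩ | ⟨ha, hb⟩ | ⟨ha, hb⟩ | ⟨ha, hb⟩ | ⟨ha, hb⟩ | ⟨ha, hb⟩ | ⟨ha, hb⟩ |
      ⟨ha, hb⟩ | ⟨ha, hb⟩
    · exact Or.inl (Or.inl (Or.inl (Or.inl (Or.inl ⟨⟨h1, ha⟩, ⟨h2, hb⟩⟩))))
    · exact Or.inl (Or.inl (Or.inl (Or.inl (Or.inr ⟨⟨h1, hb⟩, ⟨h2, ha⟩⟩))))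
    · exact Or.inl (Or.inl (Or.inl (Or.inr ⟨⟨h1, Or.inl ha⟩, ⟨h2, Or.inr hb⟩, fun h => by rw [h] at ha; omega⟩)))
    · exact Or.inl (Or.inl (Or.inl (Or.inr ⟨⟨h1, Or.inr ha⟩, ⟨h2, Or.inl hb⟩, fun h => by rw [h] at ha; omega⟩)))
    · exact Or.inl (Or.inl (Or.inr ⟨⟨h1, Or.inl ha⟩, ⟨h2, Or.inr hb⟩, fun h => by rw [h] at ha; omega⟩))
    · exact Or.inl (Or.inl (Or.inr ⟨⟨h1, Or.inr ha⟩, ⟨h2, Or.inl hb⟩, fun h => by rw [h] at ha; omega⟩))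
    · exact Or.inl (Or.inr ⟨⟨h1, Or.inl ha⟩, ⟨h2, Or.inr hb⟩, fun h => by rw [h] at ha; omega⟩)
    · exact Or.inl (Or.inr ⟨⟨h1, Or.inr ha⟩, ⟨h2, Or.inl hb⟩, fun h => by rw [h] at ha; omega⟩)
    · exact Or.inr ⟨⟨h1, Or.inl ha⟩, ⟨h2, Or.inr hb⟩, fun h => by rw [h] at ha; omega⟩
    · exact Or.inr ⟨⟨h1, Or.inr ha⟩, ⟨h2, Or.inl hb⟩, fun h => by rw [h] at ha; omega⟩
  calc ((S ×ˢ S).filter (fun p => (starPlusFour k).Adj p.1 p.2)).card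
      ≤ (C ×ˢ S' ∪ S' ×ˢ C ∪ P.offDiag ∪ Q.offDiag ∪ W.offDiag ∪ X.offDiag).card := card_le_card hsub
    _ ≤ (C ×ˢ S' ∪ S' ×ˢ C ∪ P.offDiag ∪ Q.offDiag ∪ W.offDiag).card + X.offDiag.card := card_union_le _ _
    _ ≤ (C ×ˢ S' ∪ S' ×ˢ C ∪ P.offDiag ∪ Q.offDiag).card + W.offDiag.card + X.offDiag.card := by
        gcongr; exact card_union_le _ _
    _ ≤ (C ×ˢ S' ∪ S' ×ˢ C ∪ P.offDiag).card + Q.offDiag.card + W.offDiag.card + X.offDiag.card := by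
        gcongr; exact card_union_le _ _
    _ ≤ (C ×ˢ S' ∪ S' ×ˢ C).card + P.offDiag.card + Q.offDiag.card + W.offDiag.card + X.offDiag.card := by
        gcongr; exact card_union_le _ _
    _ ≤ (C ×ˢ S').card + (S' ×ˢ C).card + P.offDiag.card + Q.offDiag.card + W.offDiag.card +
          X.offDiag.card := by
        gcongr; exact card_union_le _ _
    _ = 2 * (C.card * S'.card) + P.offDiag.card + Q.offDiag.card + W.offDiag.card + X.offDiag.card := by
        rw [card_product, card_product]; ring

/-- The traces of `S` on `{1, 2}`, `{3, 4}`, `{5, 6}` and `{7, 8}` are pairwise disjoint subsets of `S ∖ {0}`. -/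
theorem card_filter_four_traces_le (k : ℕ) (S : Finset (Fin k)) :
    (S.filter (fun i : Fin k => i.val = 1 ∨ i.val = 2)).card +
        (S.filter (fun i : Fin k => i.val = 3 ∨ i.val = 4)).card +
        (S.filter (fun i : Fin k => i.val = 5 ∨ i.val = 6)).card +
        (S.filter (fun i : Fin k => i.val = 7 ∨ i.val = 8)).card ≤
      (S.filter (fun i : Fin k => ¬ i.val = 0)).card := by
  have h1 : Disjoint (S.filter (fun i : Fin k => i.val = 1 ∨ i.val = 2))
      (S.filter (fun i : Fin k => i.val = 3 ∨ i.val = 4)) := by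
    rw [disjoint_left]
    intro i hi hi'
    rw [mem_filter] at hi hi'
    omega
  have h2 : Disjoint (S.filter (fun i : Fin k => i.val = 1 ∨ i.val = 2) ∪
      S.filter (fun i : Fin k => i.val = 3 ∨ i.val = 4)) (S.filter (fun i : Fin k => i.val = 5 ∨ i.val = 6)) := by
    rw [disjoint_left]
    intro i hi hi'
    rw [mem_union, mem_filter, mem_filter] at hi
    rw [mem_filter] at hi'
    omega
  have h3 : Disjoint (S.filter (fun i : Fin k => i.val = 1 ∨ i.val = 2) ∪
      S.filter (fun i : Fin k => i.val = 3 ∨ i.val = 4) ∪ S.filter (fun i : Fin k => i.val = 5 ∨ i.val = 6))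
      (S.filter (fun i : Fin k => i.val = 7 ∨ i.val = 8)) := by
    rw [disjoint_left]
    intro i hi hi'
    rw [mem_union, mem_union, mem_filter, mem_filter, mem_filter] at hi
    rw [mem_filter] at hi'
    omega
  rw [← card_union_of_disjoint h1, ← card_union_of_disjoint h2, ← card_union_of_disjoint h3]
  apply card_le_card
  intro i hi
  rw [mem_union, mem_union, mem_union, mem_filter, mem_filter, mem_filter, mem_filter] at hi
  rw [mem_filter]
  rcases hi with ((⟨h1, h2⟩ | ⟨h1, h2⟩) | ⟨h1, h2⟩) | ⟨h1, h2⟩ <;> exact ⟨h1, by omega⟩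

/-- **`starPlusFour k` is `K₄⁻`-free.** -/
theorem k4mFree_starPlusFour (k : ℕ) : K4mFree (starPlusFour k) := by
  intro S hS
  have h := adjPairs_starPlusFour_le k S
  have hsum := card_filter_add_card_filter_not (s := S) (fun i : Fin k => i.val = 0)
  rw [hS] at hsum
  have hC : (S.filter (fun i : Fin k => i.val = 0)).card ≤ 1 := card_filter_val_eq_le_one k 0 S
  have hP : (S.filter (fun i : Fin k => i.val = 1 ∨ i.val = 2)).card ≤ 2 := by
    rw [filter_or]
    exact (card_union_le _ _).trans
      (Nat.add_le_add (card_filter_val_eq_le_one k 1 S) (card_filter_val_eq_le_one k 2 S))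
  have hQ : (S.filter (fun i : Fin k => i.val = 3 ∨ i.val = 4)).card ≤ 2 := by
    rw [filter_or]
    exact (card_union_le _ _).trans
      (Nat.add_le_add (card_filter_val_eq_le_one k 3 S) (card_filter_val_eq_le_one k 4 S))
  have hW : (S.filter (fun i : Fin k => i.val = 5 ∨ i.val = 6)).card ≤ 2 := by
    rw [filter_or]
    exact (card_union_le _ _).trans
      (Nat.add_le_add (card_filter_val_eq_le_one k 5 S) (card_filter_val_eq_le_one k 6 S))
  have hX : (S.filter (fun i : Fin k => i.val = 7 ∨ i.val = 8)).card ≤ 2 := by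
    rw [filter_or]
    exact (card_union_le _ _).trans
      (Nat.add_le_add (card_filter_val_eq_le_one k 7 S) (card_filter_val_eq_le_one k 8 S))
  have hPQWX := card_filter_four_traces_le k S
  rw [offDiag_card, offDiag_card, offDiag_card, offDiag_card] at h
  set x := (S.filter (fun i : Fin k => i.val = 0)).card with hx
  set y := (S.filter (fun i : Fin k => ¬ i.val = 0)).card with hy
  set p := (S.filter (fun i : Fin k => i.val = 1 ∨ i.val = 2)).card with hp
  set q := (S.filter (fun i : Fin k => i.val = 3 ∨ i.val = 4)).card with hq
  set r := (S.filter (fun i : Fin k => i.val = 5 ∨ i.val = 6)).card with hr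
  set t := (S.filter (fun i : Fin k => i.val = 7 ∨ i.val = 8)).card with ht
  clear_value x y p q r t
  interval_cases x <;> interval_cases p <;> interval_cases q <;> interval_cases r <;> interval_cases t <;> omega

/-- The neighbours of the centre are all the other vertices. -/
theorem filter_adj_starPlusFour_centre (k : ℕ) (c : Fin k) (hc : c.val = 0) :
    univ.filter (fun w => (starPlusFour k).Adj c w) = univ.erase c := by
  ext w
  rw [mem_filter, mem_erase, starPlusFour_adj]
  constructor
  · rintro ⟨_, (⟨_, h2⟩ | ⟨h1, h2⟩ | ⟨h1, _⟩ | ⟨h1, _⟩ | ⟨h1, _⟩ | ⟨h1, _⟩ | ⟨h1, _⟩ | ⟨h1, _⟩ | ⟨h1, _⟩ |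
      ⟨h1, _⟩)⟩
    · exact ⟨fun h => h2 (by rw [h]; exact hc), mem_univ _⟩
    all_goals omega
  · rintro ⟨hne, _⟩
    exact ⟨mem_univ _, Or.inl ⟨hc, fun h => hne (Fin.ext (h.trans hc.symm))⟩⟩

/-- The centre has degree `k − 1`. -/
theorem deg_starPlusFour_centre (k : ℕ) (c : Fin k) (hc : c.val = 0) :
    deg (starPlusFour k) c = k - 1 := by
  unfold deg
  rw [filter_adj_starPlusFour_centre k c hc, card_erase_of_mem (mem_univ c), card_univ, Fintype.card_fin]

/-- The neighbours of a leaf `n ∈ {1, …, 8}` are the centre and its twin `n'` (`k ≥ 9`). -/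
theorem filter_adj_starPlusFour_leaf (k : ℕ) (hk : 9 ≤ k) (n n' : ℕ) (hn : n < k) (hn' : n' < k)
    (h : (n = 1 ∧ n' = 2) ∨ (n = 2 ∧ n' = 1) ∨ (n = 3 ∧ n' = 4) ∨ (n = 4 ∧ n' = 3) ∨ (n = 5 ∧ n' = 6) ∨
      (n = 6 ∧ n' = 5) ∨ (n = 7 ∧ n' = 8) ∨ (n = 8 ∧ n' = 7)) :
    univ.filter (fun w => (starPlusFour k).Adj ⟨n, hn⟩ w) = {(⟨0, by omega⟩ : Fin k), ⟨n', hn'⟩} := by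
  rcases h with ⟨rfl, rfl⟩ | ⟨rfl, rfl⟩ | ⟨rfl, rfl⟩ | ⟨rfl, rfl⟩ | ⟨rfl, rfl⟩ | ⟨rfl, rfl⟩ | ⟨rfl, rfl⟩ |
    ⟨rfl, rfl⟩ <;>
  · ext w
    rw [mem_filter, starPlusFour_adj, mem_insert, mem_singleton, Fin.ext_iff, Fin.ext_iff]
    simp only [mem_univ, true_and]
    omega

/-- A leaf `1 ≤ v ≤ 8` has degree `2` (`k ≥ 9`). -/
theorem deg_starPlusFour_leaf (k : ℕ) (hk : 9 ≤ k) (v : Fin k) (hv1 : 1 ≤ v.val) (hv8 : v.val ≤ 8) :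
    deg (starPlusFour k) v = 2 := by
  obtain ⟨n, hn⟩ := v
  simp only at hv1 hv8
  unfold deg
  have key : ∀ n' : ℕ, n' < k → ((n = 1 ∧ n' = 2) ∨ (n = 2 ∧ n' = 1) ∨ (n = 3 ∧ n' = 4) ∨
      (n = 4 ∧ n' = 3) ∨ (n = 5 ∧ n' = 6) ∨ (n = 6 ∧ n' = 5) ∨ (n = 7 ∧ n' = 8) ∨ (n = 8 ∧ n' = 7)) →
      (univ.filter (fun w => (starPlusFour k).Adj ⟨n, hn⟩ w)).card = 2 := by
    intro n' hn' h
    rw [filter_adj_starPlusFour_leaf k hk n n' hn hn' h, card_pair]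
    rw [Ne, Fin.ext_iff]
    simp only
    omega
  rcases (by omega : n = 1 ∨ n = 2 ∨ n = 3 ∨ n = 4 ∨ n = 5 ∨ n = 6 ∨ n = 7 ∨ n = 8) with
    h | h | h | h | h | h | h | h
  · exact key 2 (by omega) (Or.inl ⟨h, rfl⟩)
  · exact key 1 (by omega) (Or.inr (Or.inl ⟨h, rfl⟩))
  · exact key 4 (by omega) (Or.inr (Or.inr (Or.inl ⟨h, rfl⟩)))
  · exact key 3 (by omega) (Or.inr (Or.inr (Or.inr (Or.inl ⟨h, rfl⟩))))
  · exact key 6 (by omega) (Or.inr (Or.inr (Or.inr (Or.inr (Or.inl ⟨h, rfl⟩)))))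
  · exact key 5 (by omega) (Or.inr (Or.inr (Or.inr (Or.inr (Or.inr (Or.inl ⟨h, rfl⟩))))))
  · exact key 8 (by omega) (Or.inr (Or.inr (Or.inr (Or.inr (Or.inr (Or.inr (Or.inl ⟨h, rfl⟩)))))))
  · exact key 7 (by omega) (Or.inr (Or.inr (Or.inr (Or.inr (Or.inr (Or.inr (Or.inr ⟨h, rfl⟩)))))))

/-- The neighbours of a vertex `v ≥ 9` lie in `{0}`. -/
theorem filter_adj_starPlusFour_far_subset (k : ℕ) (v : Fin k) (hv : 9 ≤ v.val) :
    univ.filter (fun w => (starPlusFour k).Adj v w) ⊆ univ.filter (fun i : Fin k => i.val = 0) := by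
  intro w hw
  rw [mem_filter, starPlusFour_adj] at hw
  rw [mem_filter]
  refine ⟨mem_univ _, ?_⟩
  rcases hw.2 with ⟨h1, _⟩ | ⟨h1, _⟩ | ⟨h1, _⟩ | ⟨h1, _⟩ | ⟨h1, _⟩ | ⟨h1, _⟩ | ⟨h1, _⟩ | ⟨h1, _⟩ | ⟨h1, _⟩ |
    ⟨h1, _⟩ <;> omega

/-- A vertex `v ≥ 9` has degree exactly `1` (it sees the centre). -/
theorem deg_starPlusFour_far (k : ℕ) (v : Fin k) (hv : 9 ≤ v.val) : deg (starPlusFour k) v = 1 := by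
  have hle : deg (starPlusFour k) v ≤ 1 :=
    (card_le_card (filter_adj_starPlusFour_far_subset k v hv)).trans (card_filter_val_eq_le_one k 0 univ)
  have hpos : 1 ≤ deg (starPlusFour k) v := by
    unfold deg
    rw [Nat.one_le_iff_ne_zero, ← pos_iff_ne_zero, card_pos]
    exact ⟨⟨0, by omega⟩, by
      rw [mem_filter, starPlusFour_adj]
      exact ⟨mem_univ _, Or.inr (Or.inl ⟨rfl, by omega⟩)⟩⟩
  omega

/-- The degree of every vertex of `starPlusFour k` (`k ≥ 9`), as a function of its value. -/
theorem deg_starPlusFour (k : ℕ) (hk : 9 ≤ k) (v : Fin k) :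
    deg (starPlusFour k) v = if v.val = 0 then k - 1 else if v.val ≤ 8 then 2 else 1 := by
  split_ifs with h0 h8
  · exact deg_starPlusFour_centre k v h0
  · exact deg_starPlusFour_leaf k hk v (by omega) h8
  · exact deg_starPlusFour_far k v (by omega)

/-- `Σ_v C(d(v), 2) = C(k − 1, 2) + 8` on `starPlusFour k` (`k ≥ 9`). -/
theorem cherries_starPlusFour (k : ℕ) (hk : 9 ≤ k) :
    cherries (starPlusFour k) = (k - 1).choose 2 + 8 := by
  unfold cherries
  rw [sum_congr rfl (fun v _ => by rw [deg_starPlusFour k hk v])]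
  rw [Fin.sum_univ_eq_sum_range
    (fun i => (if i = 0 then k - 1 else if i ≤ 8 then 2 else 1).choose 2) k]
  obtain ⟨j, rfl⟩ : ∃ j, k = j + 9 := ⟨k - 9, by omega⟩
  rw [add_comm j 9, sum_range_add]
  have hrest : ∑ x ∈ range j, (if 9 + x = 0 then 9 + j - 1 else if 9 + x ≤ 8 then 2 else 1).choose 2 = 0 := by
    apply sum_eq_zero
    intro x _
    rw [if_neg (by omega), if_neg (by omega)]
    rfl
  rw [hrest, sum_range_succ, sum_range_succ, sum_range_succ, sum_range_succ, sum_range_succ,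
    sum_range_succ, sum_range_succ, sum_range_succ, sum_range_succ, sum_range_zero]
  norm_num

/-- `Σ_v d(v) = 2k + 6` on `starPlusFour k` (`k ≥ 9`). -/
theorem sum_deg_starPlusFour (k : ℕ) (hk : 9 ≤ k) : ∑ v, deg (starPlusFour k) v = 2 * k + 6 := by
  rw [sum_congr rfl (fun v _ => by rw [deg_starPlusFour k hk v])]
  rw [Fin.sum_univ_eq_sum_range (fun i => if i = 0 then k - 1 else if i ≤ 8 then 2 else 1) k]
  obtain ⟨j, rfl⟩ : ∃ j, k = j + 9 := ⟨k - 9, by omega⟩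
  rw [add_comm j 9, sum_range_add]
  have hrest : ∑ x ∈ range j, (if 9 + x = 0 then 9 + j - 1 else if 9 + x ≤ 8 then 2 else 1) = j := by
    rw [sum_congr rfl (fun x _ => by rw [if_neg (by omega), if_neg (by omega)])]
    rw [sum_const, card_range, smul_eq_mul, mul_one]
  rw [hrest, sum_range_succ, sum_range_succ, sum_range_succ, sum_range_succ, sum_range_succ,
    sum_range_succ, sum_range_succ, sum_range_succ, sum_range_succ, sum_range_zero]
  norm_num
  omega

/-- `starPlusFour k` has `k + 3` edges (handshake; `k ≥ 9`). -/
theorem card_edges_starPlusFour (k : ℕ) (hk : 9 ≤ k) : (starPlusFour k).edgeFinset.card = k + 3 := by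
  have h := sum_deg_eq (starPlusFour k)
  rw [sum_deg_starPlusFour k hk] at h
  omega

/-- **THE ROW `m = k + 3` IS ATTAINED:** for `k ≥ 9` a `K₄⁻`-free graph on `Fin k` with `k + 3` edges and
`Σ_v C(d(v), 2) = C(k − 1, 2) + 8`. -/
theorem exists_k4mFree_row_plus_three (k : ℕ) (hk : 9 ≤ k) :
    ∃ (D : SimpleGraph (Fin k)) (_ : DecidableRel D.Adj),
      K4mFree D ∧ D.edgeFinset.card = k + 3 ∧ cherries D = (k - 1).choose 2 + 8 :=
  ⟨starPlusFour k, inferInstance, k4mFree_starPlusFour k, card_edges_starPlusFour k hk,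
    cherries_starPlusFour k hk⟩

/-- **THE ROWS `m = k + 3` ARE SOLVED EXACTLY** (`k ≥ 9`): every `K₄⁻`-free graph on `Fin k` with `k + 3` edges
has `Σ_v C(d(v), 2) ≤ C(k − 1, 2) + 8`, and the star plus four disjoint leaf edges attains it — the census's
`(9, 12) 36` and every later row `(k, k + 3)` as one theorem. -/
theorem row_plus_three_exact (k : ℕ) (hk : 9 ≤ k) :
    (∀ (D : SimpleGraph (Fin k)) [DecidableRel D.Adj], K4mFree D → D.edgeFinset.card = k + 3 →
        cherries D ≤ (k - 1).choose 2 + 8) ∧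
      ∃ (D : SimpleGraph (Fin k)) (_ : DecidableRel D.Adj),
        K4mFree D ∧ D.edgeFinset.card = k + 3 ∧ cherries D = (k - 1).choose 2 + 8 :=
  ⟨fun D _ hK hD => cherries_le_of_card_edges_eq_add_three k hk D hK hD,
    exists_k4mFree_row_plus_three k hk⟩

/-- The row's values: `36 · 44 · 53` at `k = 9, 10, 11`. -/
theorem row_plus_three_values :
    cherries (starPlusFour 9) = 36 ∧ cherries (starPlusFour 10) = 44 ∧ cherries (starPlusFour 11) = 53 := by
  refine ⟨?_, ?_, ?_⟩ <;> rw [cherries_starPlusFour _ (by norm_num)] <;> decide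

end C047

end TriangleCap

end PercRepro
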